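import Summits.QuantumFields.BalabanUV.T4Continuum.Support.CovariantBlockAveraging

/-!
# T⁴ programme, spine node NE2 (U1a), tier B row B3.a — TOWER PACKAGING of the covariant block averaging:
# `B_k = √(n_k^d)·Q_k ⊗ 1` (a contraction), `E_k = √(n_k^d)·(Q_k(R_k) − Q_k ⊗ 1)` with `‖E_k‖ ≤ card o·(e^{(d+1)α} − 1)`
# UNIFORMLY IN `k` from the per-bond size `‖R^{(k)} − 1‖ ≤ α·L^{−k}`, and the Gram identity of the `aQ*Q` summand

NE2 formalisation swarm `b2b-balaban-t4-ne2-formalise-*`, leaf prover 07, row B3.a of `t4/formal/NE2/LEAVES.md`, companion of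
`Support/CovariantBlockAveraging` (the typed operator `Qcov` and its one-level size law).  Along the tower `n_k = L^k`
(`idx L M k = Tor (fine (lev L k) M) × Fin d`):
* `Bfree L M k := √(n_k^d)·Q_k ⊗ 1` — the FREE inner averaging, isometrically normalised; **`opNorm_Bfree_le : ‖B_k‖ ≤ 1`**;
* `QcovLev L M R k` — the covariant averaging at level `k` (canonical contours (1.7)+(1.18) at spacing `L^{−k}`), for a background
  tower `R : (k : ℕ) → Fin d → (idx L M k → Matrix o o ℂ)` (the data type of `Support/ColourCovariantLaplacian`);
* **`Ecov L M R k := √(n_k^d)·(QcovLev R k − Q_k ⊗ 1)`**, `Bfree_add_Ecov : B_k + E_k = √(n_k^d)·Q_k(R_k)`;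
* **`opNorm_Ecov_le : (∀ k ν i, ‖R k ν i − 1‖ ≤ α/L^k) → ∀ k, ‖E_k‖ ≤ card o·(e^{(d+1)α} − 1)`** (and `opNorm_Ecov_le'` with the
  linear constant `card o·(d+1)α·e^{(d+1)α}`) — the `ε` of the Gram-shape perturbation law of row B3.b (owner's `GramPerturbationLaw`,
  CLAIMS l.5387: `PerturbationLaws D (k ↦ a((B_k + E_k)ᴴ(B_k + E_k) − B_kᴴB_k)) J (a·ε(2b + ε)γ⁻¹) e₂` with `b = 1` here);
* **`gram_eq`**: `(B_k + E_k)ᴴ(B_k + E_k) − B_kᴴB_k = n_k^d·(Q_k(R_k)ᴴQ_k(R_k) − (Q_kᴴQ_k) ⊗ 1)` — i.e. exactly the summand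
  `a·(Q_k(U)^*Q_k(U) − Q_k^*Q_k ⊗ 1)` with the weight `Q_k^* = n^d·Q_kᴴ` of [Balaban1984PropagatorsI] (1.69) (`B5DeltaA169.QvAdj`),
  [Balaban1985BackgroundPropagators] (3.26) p.395 «Δ_a = Δ + DRD* + Q*aQ» (shape; no assertion of the dictionary B0).

HONEST FRAMING (T4-DAG p. 1).  Bookkeeping over the typed operator of the companion file; transporters are DATA; nothing printed is
a hypothesis; constants OURS; finite torus, linear layer, operator norm; NOT NE2, NOT [B9] (3.23)–(3.26) as printed, NOT infinite
volume / mass gap / Clay; spine 0/9 unchanged.  HONEST DEPENDENCY: continuum YM on T⁴ ⇐ BetaPertH ∧ nine spine estimates (0/9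
proved); BetaPertH ⇐ (D1) ∧ (D4) ∧ CAP+tail; G-an2-4 gates asym, D1 and NE2/3/4.  ABSOLUTE RULE kept; no `sorry`.
-/

noncomputable section

open scoped BigOperators ComplexConjugate Matrix Matrix.Norms.L2Operator Kronecker

namespace Summit.QuantumFields.BalabanUV.T4Continuum.CovariantBlockAveraging

open Literature.MathematicalPhysics.QuantumFieldTheory.Balaban1983to89.B5Prop11Plancherel (Tor fine)
open Literature.MathematicalPhysics.QuantumFieldTheory.Balaban1983to89.B5Block118 (QvOp)
open Literature.MathematicalPhysics.QuantumFieldTheory.Balaban1983to89.B5G183RateUnitTower (lev lev_neZero)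
open Summit.QuantumFields.BalabanUV.T4Continuum.BalabanAveragedTowerUnit (idx)
open Summit.QuantumFields.BalabanUV.T4Continuum.KroneckerLift

/-! ## §5 Tower packaging -/

section Tower

variable {d : ℕ} (L : ℕ) [NeZero L] (M : Fin d → ℕ) [hM : ∀ μ, NeZero (M μ)] {o : Type*} [Fintype o] [DecidableEq o]

variable (d) in
/-- the normalising scalar `√(n_k^d)`, `n_k = L^k`. [folklore] -/
def sqrtVol (k : ℕ) : ℂ := ((Real.sqrt (((lev L k : ℕ) : ℝ) ^ d) : ℝ) : ℂ)

/-- **THE FREE INNER AVERAGING** at level `k`, isometrically normalised and colour-lifted: `B_k = √(n_k^d)·Q_k ⊗ 1`. [folklore] -/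
def Bfree (k : ℕ) : Matrix ((Tor M × Fin d) × o) (idx L M k × o) ℂ :=
  sqrtVol d L k • (QvOp (lev L k) M ⊗ₖ (1 : Matrix o o ℂ))

/-- the covariant averaging at level `k` (canonical contours at spacing `L^{−k}`). [folklore] -/
def QcovLev (R : (k : ℕ) → Fin d → (idx L M k → Matrix o o ℂ)) (k : ℕ) : Matrix ((Tor M × Fin d) × o) (idx L M k × o) ℂ :=
  Qcov (lev L k) M (contour (lev L k) M) (R k)

/-- **THE TRANSPORT ERROR** `E_k = √(n_k^d)·(Q_k(R_k) − Q_k ⊗ 1)`, so that `√(n_k^d)·Q_k(R_k) = B_k + E_k`. [folklore] -/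
def Ecov (R : (k : ℕ) → Fin d → (idx L M k → Matrix o o ℂ)) (k : ℕ) : Matrix ((Tor M × Fin d) × o) (idx L M k × o) ℂ :=
  sqrtVol d L k • (QcovLev L M R k - QvOp (lev L k) M ⊗ₖ (1 : Matrix o o ℂ))

omit [NeZero L] hM in
/-- `√(n_k^d)` is a positive real; its norm. [folklore] -/
theorem norm_sqrtVol (k : ℕ) : ‖sqrtVol d L k‖ = Real.sqrt (((lev L k : ℕ) : ℝ) ^ d) := by
  rw [sqrtVol, Complex.norm_real, Real.norm_of_nonneg (Real.sqrt_nonneg _)]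

omit [NeZero L] hM in
/-- `B_k + E_k = √(n_k^d)·Q_k(R_k)`. [folklore] -/
theorem Bfree_add_Ecov (R : (k : ℕ) → Fin d → (idx L M k → Matrix o o ℂ)) (k : ℕ) :
    Bfree L M k + Ecov L M R k = sqrtVol d L k • QcovLev L M R k := by
  rw [Bfree, Ecov, ← smul_add, add_sub_cancel]

/-- **`‖B_k‖ ≤ 1`**. [folklore] -/
theorem opNorm_Bfree_le (k : ℕ) : ‖Bfree (o := o) L M k‖ ≤ 1 := by
  haveI := lev_neZero L k
  have hpos : 0 < Real.sqrt (((lev L k : ℕ) : ℝ) ^ d) :=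
    Real.sqrt_pos.mpr (pow_pos (by exact_mod_cast Nat.pos_of_ne_zero (NeZero.ne (lev L k))) d)
  rw [Bfree, norm_smul, norm_sqrtVol]
  calc Real.sqrt (((lev L k : ℕ) : ℝ) ^ d) * ‖QvOp (lev L k) M ⊗ₖ (1 : Matrix o o ℂ)‖
      ≤ Real.sqrt (((lev L k : ℕ) : ℝ) ^ d) * (Real.sqrt (((lev L k : ℕ) : ℝ) ^ d))⁻¹ :=
        mul_le_mul_of_nonneg_left ((opNorm_kron_le o _).trans (opNorm_QvOp_le (lev L k) M)) hpos.le
    _ = 1 := mul_inv_cancel₀ hpos.ne'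

/-- **THE SIZE LAW ALONG THE TOWER**: from the per-bond size `‖R^{(k)}_ν(i) − 1‖ ≤ α·L^{−k}` at every level,
`‖E_k‖ ≤ card o · (e^{(d+1)α} − 1)` UNIFORMLY IN `k` — the `ε` of the Gram-shape perturbation law of row B3.b. [folklore] -/
theorem opNorm_Ecov_le {R : (k : ℕ) → Fin d → (idx L M k → Matrix o o ℂ)} {α : ℝ} (hα : 0 ≤ α)
    (hR : ∀ k ν i, ‖R k ν i - 1‖ ≤ α / (lev L k : ℕ)) (k : ℕ) :
    ‖Ecov L M R k‖ ≤ Fintype.card o * (Real.exp ((d + 1 : ℕ) * α) - 1) := by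
  haveI := lev_neZero L k
  have hpos : 0 < Real.sqrt (((lev L k : ℕ) : ℝ) ^ d) :=
    Real.sqrt_pos.mpr (pow_pos (by exact_mod_cast Nat.pos_of_ne_zero (NeZero.ne (lev L k))) d)
  have hK : 0 ≤ (Fintype.card o : ℝ) * (Real.exp ((d + 1 : ℕ) * α) - 1) :=
    mul_nonneg (Nat.cast_nonneg _) (sub_nonneg.mpr (Real.one_le_exp (by positivity)))
  rw [Ecov, norm_smul, norm_sqrtVol, QcovLev]
  calc Real.sqrt (((lev L k : ℕ) : ℝ) ^ d) * ‖Qcov (lev L k) M (contour (lev L k) M) (R k) - QvOp (lev L k) M ⊗ₖ (1 : Matrix o o ℂ)‖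
      ≤ Real.sqrt (((lev L k : ℕ) : ℝ) ^ d)
          * (Fintype.card o * (Real.exp ((d + 1 : ℕ) * α) - 1) * (Real.sqrt (((lev L k : ℕ) : ℝ) ^ d))⁻¹) :=
        mul_le_mul_of_nonneg_left (opNorm_Qcov_sub_kron_le_of_bond (lev L k) M hα (hR k)) hpos.le
    _ = Fintype.card o * (Real.exp ((d + 1 : ℕ) * α) - 1) := by
        field_simp

/-- the same with a constant LINEAR in `α`: `‖E_k‖ ≤ card o·(d+1)α·e^{(d+1)α}`. [folklore] -/
theorem opNorm_Ecov_le' {R : (k : ℕ) → Fin d → (idx L M k → Matrix o o ℂ)} {α : ℝ} (hα : 0 ≤ α)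
    (hR : ∀ k ν i, ‖R k ν i - 1‖ ≤ α / (lev L k : ℕ)) (k : ℕ) :
    ‖Ecov L M R k‖ ≤ Fintype.card o * (((d + 1 : ℕ) * α) * Real.exp ((d + 1 : ℕ) * α)) := by
  -- `e^x − 1 ≤ x·e^x` (all real `x`; in the tree as `AreaLaw.exp_sub_one_le_mul_exp`, whose module closure is not imported here)
  have hexp : ∀ x : ℝ, Real.exp x - 1 ≤ x * Real.exp x := fun x => by
    have h1 : 1 - x ≤ Real.exp (-x) := by have := Real.add_one_le_exp (-x); linarith
    have h2 : Real.exp x * (1 - x) ≤ 1 := by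
      calc Real.exp x * (1 - x) ≤ Real.exp x * Real.exp (-x) := mul_le_mul_of_nonneg_left h1 (Real.exp_nonneg x)
        _ = 1 := by rw [← Real.exp_add, add_neg_cancel, Real.exp_zero]
    nlinarith [Real.exp_nonneg x]
  exact (opNorm_Ecov_le L M hα hR k).trans (mul_le_mul_of_nonneg_left (hexp _) (Nat.cast_nonneg _))

omit [NeZero L] in
/-- **THE GRAM IDENTITY** behind the `aQ*Q` summand: `(B_k + E_k)ᴴ(B_k + E_k) − B_kᴴB_k = n_k^d·(Q_k(R_k)ᴴQ_k(R_k) − (Q_kᴴQ_k) ⊗ 1)` —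
the weight `n_k^d` is that of `B5DeltaA169.QvAdj = n^d·Q_kᴴ` in (1.69) `a⟨A, Q*QA⟩`. [folklore] -/
theorem gram_eq (R : (k : ℕ) → Fin d → (idx L M k → Matrix o o ℂ)) (k : ℕ) :
    (Bfree L M k + Ecov L M R k)ᴴ * (Bfree L M k + Ecov L M R k) - (Bfree (o := o) L M k)ᴴ * Bfree (o := o) L M k
      = (((lev L k : ℕ) : ℂ) ^ d) • ((QcovLev L M R k)ᴴ * QcovLev L M R k
          - ((QvOp (lev L k) M)ᴴ * QvOp (lev L k) M) ⊗ₖ (1 : Matrix o o ℂ)) := by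
  have hreal : star (sqrtVol d L k) = sqrtVol d L k := by rw [sqrtVol]; exact Complex.conj_ofReal _
  have hsq : sqrtVol d L k * sqrtVol d L k = ((lev L k : ℕ) : ℂ) ^ d := by
    rw [sqrtVol, ← Complex.ofReal_mul, Real.mul_self_sqrt (pow_nonneg (Nat.cast_nonneg _) d)]
    push_cast; rfl
  rw [Bfree_add_Ecov]
  rw [Bfree, Matrix.conjTranspose_smul, Matrix.conjTranspose_smul, hreal, Matrix.smul_mul, Matrix.mul_smul, smul_smul,
    Matrix.smul_mul, Matrix.mul_smul, smul_smul, hsq, ← smul_sub, kron_conjTranspose, ← kron_mul]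

end Tower

end Summit.QuantumFields.BalabanUV.T4Continuum.CovariantBlockAveraging

end
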